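import Summits.QuantumFields.BalabanUV.T4Continuum.Support.VariationalVectorEndMonotone
import Summits.QuantumFields.BalabanUV.T4Continuum.Support.VariationalVectorGaugeSliceDist

/-!
# T⁴ programme, spine node NE2 (U1a), lane P2 — «V-AVG-G»: THE LOWER BRACKET OF THE VECTOR END WITHOUT A SLICE MOVE
# (curl Federbush AT `G := 0` ∧ (G″) «the coarse gauge functional of the averaged fine minimiser is below the fine one»; abstract + vector letters;
# model level; cell `pub-balaban`)

NE2 formalisation swarm `b2b-balaban-t4-ne2-formalise-*`, leaf prover 10 GEN 4 (`prover-b2b-balaban-t4-ne2-formalise-leaf-10-g4-0`, V-END holder lineage);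
journal INTENT «V-AVG-G: THE LOWER BRACKET WITHOUT A SLICE MOVE» CLAIMS.log 2026-08-20 18:22Z l.19093.  The DOWNWARD twin of leaf-01-g8's
`VariationalVectorGaugeSliceDist.hONEm_of_curl_oneG` (p229806, the upward (G′) route); over the road's spine BY NAME (`blockSpin_le`, `blockSpin_eq_of_isMin`,
`exists_isMinOn_fib`, `defect_bound`), this lineage's `VariationalVectorEndMonotone.upper_bracket_of_oneMin` (p226720), the defect constants `eV` ∕ `ePV` of
`VariationalVectorEndOfLeaves` (p220074) and the form splittings `VariationalVectorGaugeMove.ScV_eq_zero_add` (p223848) ∕ `VariationalVectorGaugeSliceDist.SfV_eq_zero_add`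
(p229806); nothing defined.

WHY.  In the END of record (`VariationalAssemblySliceMin.pair_bracket_sqrt_min` p224582 → `VariationalVectorEndOfLeavesMin` p225541) the LOWER bracket
`Δ_k(φ) ≤ Δ_{k+1}(φ) + e_k·‖φ‖²` is reached by pushing a fine minimiser `g₀` of the composite fibre down (`W = Q₁ g₀`; curl Federbush `hFEDcurl` AT `G := 0`,
landed with background) and then RE-FIXING THE COARSE GAUGE by a slice move ((SLICE-min): `∃ Ws` in the fibre with `Sc Ws ≤ (1+σ′)·Scc (Q₁ g₀) + σ·qW (Q₁ g₀)`).
With background the slice move is where the located, level-independent cost lives (leaf-01-g7's memo `t4/T4-EST-NE2-P2-VGF.md` (V1)∕(V2): the move costs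
`‖F_R λ‖`, a commutator of the size of the curvature times the slice distance).  The move is not needed: exactly as leaf-01-g8 disposed of the UPWARD slice
move by comparing the fine gauge functional of the competitor with the coarse one ((G′) «V-ONE-G»), the LOWER bracket only needs the coarse gauge functional
OF THE PUSHED-DOWN FIELD ITSELF compared with the fine one:
  (G″) «V-AVG-G»   `Gc (Q₁ g₀) ≤ (√(Gf g₀) + ε″·√(ρ′ g₀))²`   at fine minimisers `g₀` of the composite fibre
(square-root shape, coefficient ONE on `Gf` — in the vector letters `Gc W = (n^d)⁻¹(n²·G W)`, `Gf W′ = ((nL)^d)⁻¹((nL)²·G′ W′)`, and the block mean is an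
exact contraction between these two normalisations; `ε″` a first-order defect, `ρ′` a fine regularity functional with its own V-REG at fine minimisers).  Then
  `Sc (Q₁ g₀) = Scc (Q₁ g₀) + Gc (Q₁ g₀) ≤ (√(Sff g₀) + δ√(qV g₀))² + (√(Gf g₀) + ε″√(ρ′ g₀))² ≤ (√(Sf g₀) + δ√(qV g₀) + ε″√(ρ′ g₀))²`
by `x√a + y√b ≤ (x + y)√(a + b)` (§1), and the usual size bookkeeping (`Sf g₀ ≤ Λ‖φ‖²`, fine V-P, fine V-REG) turns the square root into the ADDITIVE defect
`eV Λ (C_P + C_R′) (δ + ε″)·‖φ‖²` — `eV` of p220074 BY NAME, so the END's rate lemma `eV_level_le` applies unchanged.  NO σ, NO σ′, no slice law; every term of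
the lower defect is first order in the small quantities `δ` (transport mismatch) and `ε″`.
 * §1 `sq_sqrt_add_sq_sqrt_add_le` — `(√a + x)² + (√b + y)² ≤ (√(a + b) + (x + y))²`.
 * §2 **`lower_bracket_of_fed_avgG`** (abstract `blockSpin` level; the twin of `upper_bracket_of_oneMin`): fine minimiser (fine V-P coercivity + fine V-UB),
   `hFEDc` against the PURE-curl fine form `Sff`, `hAVGG` = (G″) localised at fine minimisers, `hREGf` = V-REG at fine minimisers of the composite fibre;
   `blockSpin Qk Sc μ ≤ blockSpin (Qk ∘ Q₁) Sf μ + eV Λ (CP + CR′) (δ + ε″)·qZ μ`; and **`pair_bracket_sqrt_avgG`**: both brackets — the lower one from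
   (FED)₀ ∧ (G″), the upper one = `upper_bracket_of_oneMin` ((ONE-min), V-REG, coarse V-P ∕ V-UB) VERBATIM, defect `ePV Λ CP CR ε₁ δ′`.
 * §3 vector letters (`E` finite-dimensional; `Q₁ := QvL L (fine n M) T′` with `T′` DATA — NO contractivity needed any more; `Qk` DATA):
   **`vector_lower_bracket_avgG`**, **`vector_pair_bracket_sqrt_avgG_line`** — the `hbr k φ` binder of `VariationalVectorTower.towerLimitRate_effV_of_pairs`
   (p218948) with sockets hUBc ∕ hUBf ∕ hPc ∕ hPf ∕ hFEDcurl ∕ **hAVGG** ∕ hONEm ∕ hREG ∕ **hREGf**.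
The END over these brackets (`towerLimitRate_effV_of_leaves_avgG`: p225541 with the (SLICE-min) socket REPLACED by hAVGG + hREGf, nothing else changed) is the
next file `VariationalVectorEndOfLeavesAvgG`; the decomposition of (G″) into DIV-AVG (the commutator `div_R ∘ Q_{T′} − L·Q₀ ∘ div_{R′}` on regular fields) and
HARM-APPROX↓ (the pushdown of a fine `K′`-harmonic 0-form is close to a coarse `K`-harmonic one — the dual of leaf-01-g8's `harmApprox_*`) follows separately.

HONEST FRAMING (T4-DAG p. 1).  Abstract bookkeeping on `blockSpin` + real arithmetic at MODEL level (`E`-valued 1-forms, transports ∕ carriers ∕ functionals DATA,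
c5); every leaf ∕ law is a DISPLAYED binder, none discharged here — in particular (G″) WITH BACKGROUND IS NOT PROVED HERE; [folklore]; nothing printed is a
hypothesis; no `def`, no `def … : Prop`, no `sorry`; axioms standard.  V-END with background ∕ NE2 NOT proved; NE3 OPEN; spine PROVED 0∕9 unchanged; rung (B)+1 on
a fixed finite T⁴ — NOT infinite volume, NOT mass gap, NOT Clay.  HONEST DEPENDENCY (cell, verbatim): continuum YM on T⁴ ⇐ BetaPertH ∧ nine spine estimates
(0/9 proved); BetaPertH ⇐ (D1) ∧ (D4) ∧ CAP+tail; G-an2-4 gates asym, D1 and NE2/3/4.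
-/

noncomputable section

namespace Summit.QuantumFields.BalabanUV.T4Continuum.VariationalVectorLowerAvgG

open Finset
open Literature.MathematicalPhysics.QuantumFieldTheory.Balaban1983to89.B5Prop11Plancherel (Tor fine unitVec)
open Summit.QuantumFields.BalabanUV.T4Continuum.VariationalTransfer (blockSpin blockSpin_le blockSpin_eq_of_isMin)
open Summit.QuantumFields.BalabanUV.T4Continuum.VariationalCovariantAssembly (exists_isMinOn_fib defect_bound)
open Summit.QuantumFields.BalabanUV.T4Continuum.VectorBlockTrialForm (nsqV nsqV_nonneg QvL)
open Summit.QuantumFields.BalabanUV.T4Continuum.VariationalVectorForm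
open Summit.QuantumFields.BalabanUV.T4Continuum.VariationalVectorAverage (continuous_QvL)
open Summit.QuantumFields.BalabanUV.T4Continuum.VariationalVectorEndOfLeaves (eV ePV)
open Summit.QuantumFields.BalabanUV.T4Continuum.VariationalVectorEndMonotone (upper_bracket_of_oneMin)
open Summit.QuantumFields.BalabanUV.T4Continuum.VariationalVectorGaugeMove (ScV_eq_zero_add)
open Summit.QuantumFields.BalabanUV.T4Continuum.VariationalVectorGaugeSliceDist (SfV_eq_zero_add)

/-! ## §1 Two square roots under one -/

section Real

/-- `(√a + x)² + (√b + y)² ≤ (√(a + b) + (x + y))²` for `0 ≤ a, b, x, y` — Cauchy–Schwarz `x√a + y√b ≤ (x + y)·√(a + b)` in its crudest form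
(`√a, √b ≤ √(a + b)`, `0 ≤ xy`). [folklore] -/
theorem sq_sqrt_add_sq_sqrt_add_le {a b x y : ℝ} (ha : 0 ≤ a) (hb : 0 ≤ b) (hx : 0 ≤ x) (hy : 0 ≤ y) :
    (Real.sqrt a + x) ^ 2 + (Real.sqrt b + y) ^ 2 ≤ (Real.sqrt (a + b) + (x + y)) ^ 2 := by
  have h1 : Real.sqrt a ≤ Real.sqrt (a + b) := Real.sqrt_le_sqrt (by linarith)
  have h2 : Real.sqrt b ≤ Real.sqrt (a + b) := Real.sqrt_le_sqrt (by linarith)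
  have h3 : Real.sqrt a ^ 2 = a := Real.sq_sqrt ha
  have h4 : Real.sqrt b ^ 2 = b := Real.sq_sqrt hb
  have h5 : Real.sqrt (a + b) ^ 2 = a + b := Real.sq_sqrt (by linarith)
  nlinarith [mul_le_mul_of_nonneg_left h1 hx, mul_le_mul_of_nonneg_left h2 hy, mul_nonneg hx hy, Real.sqrt_nonneg a, Real.sqrt_nonneg b]

/-- monotonicity of the square-root shape in the leading term: `a ≤ a′ ⟹ (√a + u)² ≤ (√a′ + u)²` for `0 ≤ u`. [folklore] -/
theorem sq_sqrt_add_mono {a a' u : ℝ} (haa : a ≤ a') (hu : 0 ≤ u) : (Real.sqrt a + u) ^ 2 ≤ (Real.sqrt a' + u) ^ 2 :=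
  pow_le_pow_left₀ (by positivity) (by linarith [Real.sqrt_le_sqrt haa]) 2

end Real

/-! ## §2 The abstract lower bracket from (FED)₀ ∧ (G″), and the pair -/

section Abstract

variable {V W Z : Type*} [NormedAddCommGroup V] [ProperSpace V]

/-- **THE LOWER BRACKET WITHOUT A SLICE MOVE.**  Coarse form `Sc ≤ Scc + Gc` (pure curl + gauge functional), fine form `Sff + Gf ≤ Sf`; a fine minimiser `g₀` of
`Sf` on the composite fibre `{Qk ∘ Q₁ = μ}` exists by fine V-P coercivity + fine V-UB; the curl Federbush `Scc (Q₁ f′) ≤ (√(Sff f′) + δ√(qV f′))²` AT `G := 0`;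
(G″) «V-AVG-G» AT FINE MINIMISERS `Gc (Q₁ g₀) ≤ (√(Gf g₀) + ε″√(ρ′ g₀))²`; fine V-REG `ρ′ g₀ ≤ C_R′(Sf g₀ + qZ μ)` at fine minimisers.  Then
`blockSpin Qk Sc μ ≤ blockSpin (Qk ∘ Q₁) Sf μ + eV Λ (C_P + C_R′) (δ + ε″)·qZ μ` — the lower defect of p220652 ∕ p224582 with `σ = σ′ = 0` and `δ ↦ δ + ε″`,
`C_P ↦ C_P + C_R′`.  No slice law, no contractivity of `Q₁`, nothing at the coarse level but `0 ≤ Sc`. [folklore] -/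
theorem lower_bracket_of_fed_avgG [NormedAddCommGroup W] [TopologicalSpace Z] [T1Space Z]
    {Qk : W → Z} {Q₁ : V → W} {Sc Scc Gc : W → ℝ} {Sf Sff Gf : V → ℝ} {qV : V → ℝ} {qZ : Z → ℝ} {ρ' : V → ℝ}
    (hQk : Continuous Qk) (hQ₁ : Continuous Q₁) (hSf : Continuous Sf)
    (hSc0 : ∀ f, 0 ≤ Sc f) (hSf0 : ∀ f', 0 ≤ Sf f') (hSff0 : ∀ f', 0 ≤ Sff f') (hGf0 : ∀ f', 0 ≤ Gf f')
    (hqZ0 : ∀ μ, 0 ≤ qZ μ)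
    (hScle : ∀ f, Sc f ≤ Scc f + Gc f) (hSfle : ∀ f', Sff f' + Gf f' ≤ Sf f')
    {κ Λ CP CR' δ ε'' : ℝ} (hκ : 0 ≤ κ) (hΛ : 0 ≤ Λ) (hCP : 0 ≤ CP) (hCR' : 0 ≤ CR') (hδ : 0 ≤ δ) (hε'' : 0 ≤ ε'')
    (hnormV : ∀ f', ‖f'‖ ^ 2 ≤ κ * qV f')
    -- fine V-UB and fine V-P
    (hUBf : ∀ μ, ∃ f', Qk (Q₁ f') = μ ∧ Sf f' ≤ Λ * qZ μ)
    (hPf : ∀ f', qV f' ≤ CP * (Sf f' + qZ (Qk (Q₁ f'))))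
    -- the curl Federbush AT `G := 0`, (G″) AT FINE MINIMISERS, and V-REG AT FINE MINIMISERS
    (hFEDc : ∀ f', Scc (Q₁ f') ≤ (Real.sqrt (Sff f') + δ * Real.sqrt (qV f')) ^ 2)
    (hAVGG : ∀ μ g₀, Qk (Q₁ g₀) = μ → (∀ f', Qk (Q₁ f') = μ → Sf g₀ ≤ Sf f') →
      Gc (Q₁ g₀) ≤ (Real.sqrt (Gf g₀) + ε'' * Real.sqrt (ρ' g₀)) ^ 2)
    (hREGf : ∀ μ g, Qk (Q₁ g) = μ → (∀ f', Qk (Q₁ f') = μ → Sf g ≤ Sf f') → ρ' g ≤ CR' * (Sf g + qZ μ))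
    (μ : Z) :
    blockSpin Qk Sc μ ≤ blockSpin (Qk ∘ Q₁) Sf μ + eV Λ (CP + CR') (δ + ε'') * qZ μ := by
  -- the fine minimiser for the composite constraint
  obtain ⟨gU, hgU, hgUb⟩ := hUBf μ
  have hPf' : ∀ f', qV f' ≤ CP * (Sf f' + qZ ((Qk ∘ Q₁) f')) := fun f' => by simpa using hPf f'
  obtain ⟨g₀, hg₀, hmin'⟩ := exists_isMinOn_fib (Q := Qk ∘ Q₁) (qZ := qZ) (hQk.comp hQ₁) hSf hκ hCP hnormV hPf'
    (f₁ := gU) (by simpa using hgU)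
  have hg₀' : Qk (Q₁ g₀) = μ := by simpa using hg₀
  have hminf : ∀ f', Qk (Q₁ f') = μ → Sf g₀ ≤ Sf f' := fun f' hf' => hmin' f' (by simpa using hf')
  -- sizes at the fine minimiser
  have hSf_le : Sf g₀ ≤ Λ * qZ μ := (hminf gU hgU).trans hgUb
  have hqV_le : qV g₀ ≤ CP * (Λ + 1) * qZ μ := by
    calc qV g₀ ≤ CP * (Sf g₀ + qZ (Qk (Q₁ g₀))) := hPf g₀
      _ ≤ CP * (Λ * qZ μ + qZ μ) := by rw [hg₀']; gcongr
      _ = CP * (Λ + 1) * qZ μ := by ring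
  have hρ_le : ρ' g₀ ≤ CR' * (Λ + 1) * qZ μ := by
    calc ρ' g₀ ≤ CR' * (Sf g₀ + qZ μ) := hREGf μ g₀ hg₀' hminf
      _ ≤ CR' * (Λ * qZ μ + qZ μ) := by gcongr
      _ = CR' * (Λ + 1) * qZ μ := by ring
  -- the common envelope of the two sizes
  set P : ℝ := (CP + CR') * (Λ + 1) with hPdef
  have hP0 : 0 ≤ P := by positivity
  have hΛ1 : 0 ≤ Λ + 1 := by linarith
  have hPz : P * qZ μ = CP * (Λ + 1) * qZ μ + CR' * (Λ + 1) * qZ μ := by rw [hPdef]; ring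
  have hPz0 : 0 ≤ P * qZ μ := mul_nonneg hP0 (hqZ0 μ)
  have hqV_P : qV g₀ ≤ P * qZ μ := hqV_le.trans (by rw [hPz]; linarith [mul_nonneg (mul_nonneg hCR' hΛ1) (hqZ0 μ)])
  have hρ_P : ρ' g₀ ≤ P * qZ μ := hρ_le.trans (by rw [hPz]; linarith [mul_nonneg (mul_nonneg hCP hΛ1) (hqZ0 μ)])
  -- the pushed-down competitor: Federbush on the curl part, (G″) on the gauge part, the two square roots under one
  have hE := hFEDc g₀
  have hG := hAVGG μ g₀ hg₀' hminf
  have hu0 : 0 ≤ δ * Real.sqrt (qV g₀) + ε'' * Real.sqrt (ρ' g₀) := by positivity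
  have hcomp : Sc (Q₁ g₀) ≤ (Real.sqrt (Sf g₀) + (δ * Real.sqrt (qV g₀) + ε'' * Real.sqrt (ρ' g₀))) ^ 2 := by
    calc Sc (Q₁ g₀) ≤ Scc (Q₁ g₀) + Gc (Q₁ g₀) := hScle _
      _ ≤ (Real.sqrt (Sff g₀) + δ * Real.sqrt (qV g₀)) ^ 2 + (Real.sqrt (Gf g₀) + ε'' * Real.sqrt (ρ' g₀)) ^ 2 := add_le_add hE hG
      _ ≤ (Real.sqrt (Sff g₀ + Gf g₀) + (δ * Real.sqrt (qV g₀) + ε'' * Real.sqrt (ρ' g₀))) ^ 2 :=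
          sq_sqrt_add_sq_sqrt_add_le (hSff0 g₀) (hGf0 g₀) (by positivity) (by positivity)
      _ ≤ (Real.sqrt (Sf g₀) + (δ * Real.sqrt (qV g₀) + ε'' * Real.sqrt (ρ' g₀))) ^ 2 := sq_sqrt_add_mono (hSfle g₀) hu0
  -- the two defect sizes under the common envelope: `δ√qV + ε″√ρ′ ≤ (δ + ε″)·√(P·qZ μ)`
  have hsq1 : Real.sqrt (qV g₀) ≤ Real.sqrt (P * qZ μ) := Real.sqrt_le_sqrt hqV_P
  have hsq2 : Real.sqrt (ρ' g₀) ≤ Real.sqrt (P * qZ μ) := Real.sqrt_le_sqrt hρ_P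
  have hu_le : δ * Real.sqrt (qV g₀) + ε'' * Real.sqrt (ρ' g₀) ≤ (δ + ε'') * Real.sqrt (P * qZ μ) := by
    nlinarith [mul_le_mul_of_nonneg_left hsq1 hδ, mul_le_mul_of_nonneg_left hsq2 hε'']
  have hcomp' : Sc (Q₁ g₀) ≤ (Real.sqrt (Sf g₀) + (δ + ε'') * Real.sqrt (P * qZ μ)) ^ 2 :=
    hcomp.trans (pow_le_pow_left₀ (by positivity) (by linarith) 2)
  -- the square root becomes the additive defect `eV Λ (CP + CR′) (δ + ε″)·qZ μ`
  have hF : Sc (Q₁ g₀) ≤ Sf g₀ + eV Λ (CP + CR') (δ + ε'') * qZ μ := by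
    have hdef := defect_bound (s := Sf g₀) (v := P * qZ μ) (z := qZ μ) (Λ := Λ) (P := P) (δ := δ + ε'') (by positivity) hΛ hP0 (hqZ0 μ)
      hSf_le le_rfl
    have h := hcomp'
    rw [add_sq, Real.sq_sqrt (hSf0 g₀), mul_pow, Real.sq_sqrt hPz0] at h
    unfold eV
    rw [hPdef] at hdef h
    linarith
  -- the LOWER bracket through the pushed-down competitor `Q₁ g₀`
  have hval : blockSpin (Qk ∘ Q₁) Sf μ = Sf g₀ := blockSpin_eq_of_isMin (Q := Qk ∘ Q₁) hSf0 hg₀ hmin'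
  rw [hval]
  exact (blockSpin_le hSc0 hg₀').trans hF

/-- **THE TWO-SIDED BRACKET WITH NO SLICE LAW**: lower = `lower_bracket_of_fed_avgG` ((FED)₀ ∧ (G″) ∧ fine V-REG, defect `eV Λ (C_P + C_R′) (δ + ε″)`), upper =
this lineage's `upper_bracket_of_oneMin` ((ONE-min) ∧ V-REG ∧ coarse V-P ∕ V-UB, defect `ePV Λ C_P C_R ε₁ δ′`) VERBATIM.  The sockets of p224582 with `hslice` and
`hQ₁size` REPLACED by `hAVGG` + `hREGf`. [folklore] -/
theorem pair_bracket_sqrt_avgG [NormedAddCommGroup W] [ProperSpace W] [TopologicalSpace Z] [T1Space Z]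
    {Qk : W → Z} {Q₁ : V → W} {Sc Scc Gc : W → ℝ} {Sf Sff Gf : V → ℝ} {qW : W → ℝ} {qV : V → ℝ} {qZ : Z → ℝ} {ρ : W → ℝ} {ρ' : V → ℝ}
    (hQk : Continuous Qk) (hQ₁ : Continuous Q₁) (hSc : Continuous Sc) (hSf : Continuous Sf)
    (hSc0 : ∀ f, 0 ≤ Sc f) (hSf0 : ∀ f', 0 ≤ Sf f') (hSff0 : ∀ f', 0 ≤ Sff f') (hGf0 : ∀ f', 0 ≤ Gf f') (hqW0 : ∀ f, 0 ≤ qW f)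
    (hqZ0 : ∀ μ, 0 ≤ qZ μ) (hρ0 : ∀ f, 0 ≤ ρ f)
    (hScle : ∀ f, Sc f ≤ Scc f + Gc f) (hSfle : ∀ f', Sff f' + Gf f' ≤ Sf f')
    {κ Λ CP CR CR' δ ε₁ δ' ε'' : ℝ} (hκ : 0 ≤ κ) (hΛ : 0 ≤ Λ) (hCP : 0 ≤ CP) (hCR : 0 ≤ CR) (hCR' : 0 ≤ CR') (hδ : 0 ≤ δ) (hε₁ : 0 ≤ ε₁)
    (hδ' : 0 ≤ δ') (hε'' : 0 ≤ ε'')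
    (hnormW : ∀ f, ‖f‖ ^ 2 ≤ κ * qW f) (hnormV : ∀ f', ‖f'‖ ^ 2 ≤ κ * qV f')
    -- leaf UB and leaf P at both levels
    (hUBc : ∀ μ, ∃ f, Qk f = μ ∧ Sc f ≤ Λ * qZ μ) (hUBf : ∀ μ, ∃ f', Qk (Q₁ f') = μ ∧ Sf f' ≤ Λ * qZ μ)
    (hPc : ∀ f, qW f ≤ CP * (Sc f + qZ (Qk f))) (hPf : ∀ f', qV f' ≤ CP * (Sf f' + qZ (Qk (Q₁ f'))))
    -- LOWER side: the curl Federbush AT `G := 0`, (G″) and V-REG at fine minimisers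
    (hFEDc : ∀ f', Scc (Q₁ f') ≤ (Real.sqrt (Sff f') + δ * Real.sqrt (qV f')) ^ 2)
    (hAVGG : ∀ μ g₀, Qk (Q₁ g₀) = μ → (∀ f', Qk (Q₁ f') = μ → Sf g₀ ≤ Sf f') →
      Gc (Q₁ g₀) ≤ (Real.sqrt (Gf g₀) + ε'' * Real.sqrt (ρ' g₀)) ^ 2)
    (hREGf : ∀ μ g, Qk (Q₁ g) = μ → (∀ f', Qk (Q₁ f') = μ → Sf g ≤ Sf f') → ρ' g ≤ CR' * (Sf g + qZ μ))
    -- UPPER side: (ONE-min) and V-REG at coarse minimisers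
    (hONEm : ∀ μ f₀, Qk f₀ = μ → (∀ f, Qk f = μ → Sc f₀ ≤ Sc f) →
      ∃ g, Qk (Q₁ g) = μ ∧ Sf g ≤ (Real.sqrt (Sc f₀ + ε₁ * ρ f₀) + δ' * Real.sqrt (qW f₀)) ^ 2)
    (hREG : ∀ μ f, Qk f = μ → (∀ g, Qk g = μ → Sc f ≤ Sc g) → ρ f ≤ CR * (Sc f + qZ μ))
    (μ : Z) :
    blockSpin Qk Sc μ ≤ blockSpin (Qk ∘ Q₁) Sf μ + eV Λ (CP + CR') (δ + ε'') * qZ μ ∧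
      blockSpin (Qk ∘ Q₁) Sf μ ≤ blockSpin Qk Sc μ + ePV Λ CP CR ε₁ δ' * qZ μ := by
  refine ⟨lower_bracket_of_fed_avgG hQk hQ₁ hSf hSc0 hSf0 hSff0 hGf0 hqZ0 hScle hSfle hκ hΛ hCP hCR' hδ hε'' hnormV hUBf hPf
    hFEDc hAVGG hREGf μ, ?_⟩
  unfold ePV
  exact upper_bracket_of_oneMin (Qk := Qk) (Q₁ := Q₁) (Sc := Sc) (Sf := Sf) (qW := qW) (qZ := qZ) (ρ := ρ) hQk hSc hSc0 hSf0 hqW0 hqZ0 hρ0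
    hκ hΛ hCP hCR hε₁ hδ' hnormW hUBc hPc hONEm hREG μ

end Abstract

/-! ## §3 Vector letters: the line-indexed one-step average, the two forms split as curl + gauge functional -/

section Vector

variable {d : ℕ} {E : Type*} [NormedAddCommGroup E] [NormedSpace ℂ E]
variable (n L : ℕ) [NeZero n] [NeZero L] (M : Fin d → ℕ) [hM : ∀ μ, NeZero (M μ)]

/-- **THE LOWER BRACKET WITHOUT A SLICE MOVE, VECTOR LETTERS** (`E` finite-dimensional): `Sc := ScV R G`, `Scc := ScV R 0`, `Gc W := (n^d)⁻¹(n²·G W)`,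
`Sf := SfV R′ G′`, `Sff := SfV R′ 0`, `Gf W′ := ((nL)^d)⁻¹((nL)²·G′ W′)`, `Q₁ := QvL L (fine n M) T′` (line carriers `T′` DATA, no contractivity), `Qk` DATA;
the curl Federbush against `SfV R′ 0`, (G″) «V-AVG-G» and V-REG at fine minimisers of the composite fibre:
`blockSpin Qk (ScV R G) φ ≤ blockSpin (Qk ∘ Q₁) (SfV R′ G′) φ + eV Λ (C_P + C_R′) (δ + ε″)·nsqV φ`. [folklore] -/
theorem vector_lower_bracket_avgG [FiniteDimensional ℂ E]
    {R : Tor (fine n M) → Fin d → (E →L[ℂ] E)} {R' : Tor (fine L (fine n M)) → Fin d → (E →L[ℂ] E)}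
    {G : (Tor (fine n M) → Fin d → E) → ℝ} {G' : (Tor (fine L (fine n M)) → Fin d → E) → ℝ}
    {Qk : (Tor (fine n M) → Fin d → E) → (Tor M → Fin d → E)} {T' : Tor (fine n M) → (Fin d → Fin L) → Fin L → Fin d → (E →L[ℂ] E)}
    (hQk : Continuous Qk) (hG0 : ∀ W, 0 ≤ G W) (hG0' : ∀ W', 0 ≤ G' W') (hGc' : Continuous G')
    {Λ CP CR' δ ε'' : ℝ} (hΛ : 0 ≤ Λ) (hCP : 0 ≤ CP) (hCR' : 0 ≤ CR') (hδ : 0 ≤ δ) (hε'' : 0 ≤ ε'')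
    {ρ' : (Tor (fine L (fine n M)) → Fin d → E) → ℝ}
    (hUBf : ∀ φ : Tor M → Fin d → E, ∃ W', Qk (QvL L (fine n M) T' W') = φ ∧ SfV n L M R' G' W' ≤ Λ * nsqV M φ)
    (hPf : ∀ W', qVV n L M W' ≤ CP * (SfV n L M R' G' W' + nsqV M (Qk (QvL L (fine n M) T' W'))))
    (hFEDcurl : ∀ W', ScV n M R (fun _ => 0) (QvL L (fine n M) T' W')
      ≤ (Real.sqrt (SfV n L M R' (fun _ => 0) W') + δ * Real.sqrt (qVV n L M W')) ^ 2)
    (hAVGG : ∀ (φ : Tor M → Fin d → E) (g₀ : Tor (fine L (fine n M)) → Fin d → E), Qk (QvL L (fine n M) T' g₀) = φ →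
      (∀ W', Qk (QvL L (fine n M) T' W') = φ → SfV n L M R' G' g₀ ≤ SfV n L M R' G' W') →
      ((n : ℝ) ^ d)⁻¹ * ((n : ℝ) ^ 2 * G (QvL L (fine n M) T' g₀))
        ≤ (Real.sqrt ((((n : ℝ) * L) ^ d)⁻¹ * (((n : ℝ) * L) ^ 2 * G' g₀)) + ε'' * Real.sqrt (ρ' g₀)) ^ 2)
    (hREGf : ∀ (φ : Tor M → Fin d → E) g, Qk (QvL L (fine n M) T' g) = φ →
      (∀ W', Qk (QvL L (fine n M) T' W') = φ → SfV n L M R' G' g ≤ SfV n L M R' G' W') → ρ' g ≤ CR' * (SfV n L M R' G' g + nsqV M φ))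
    (φ : Tor M → Fin d → E) :
    blockSpin Qk (ScV n M R G) φ ≤ blockSpin (Qk ∘ QvL L (fine n M) T') (SfV n L M R' G') φ + eV Λ (CP + CR') (δ + ε'') * nsqV M φ := by
  have hnL : (0 : ℝ) < ((n : ℝ) * L) ^ d := by
    have := Nat.pos_of_ne_zero (NeZero.ne n); have := Nat.pos_of_ne_zero (NeZero.ne L); positivity
  have hnormV : ∀ W' : Tor (fine L (fine n M)) → Fin d → E, ‖W'‖ ^ 2 ≤ ((n : ℝ) * L) ^ d * qVV n L M W' := fun W' => by
    unfold qVV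
    rw [← mul_assoc, mul_inv_cancel₀ hnL.ne', one_mul]
    exact norm_sq_le_nsqV W'
  have hGf0 : ∀ W', 0 ≤ (((n : ℝ) * L) ^ d)⁻¹ * (((n : ℝ) * L) ^ 2 * G' W') := fun W' => by have := hG0' W'; positivity
  exact lower_bracket_of_fed_avgG (V := Tor (fine L (fine n M)) → Fin d → E) (W := Tor (fine n M) → Fin d → E) (Z := Tor M → Fin d → E)
    (Qk := Qk) (Q₁ := QvL L (fine n M) T') (Sc := ScV n M R G) (Scc := ScV n M R (fun _ => 0)) (Gc := fun W => ((n : ℝ) ^ d)⁻¹ * ((n : ℝ) ^ 2 * G W))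
    (Sf := SfV n L M R' G') (Sff := SfV n L M R' (fun _ => 0)) (Gf := fun W' => (((n : ℝ) * L) ^ d)⁻¹ * (((n : ℝ) * L) ^ 2 * G' W'))
    (qV := qVV n L M) (qZ := nsqV M) (ρ' := ρ')
    hQk (continuous_QvL L (fine n M) T') (continuous_SfV n L M R' hGc') (ScV_nonneg n M R hG0) (SfV_nonneg n L M R' hG0')
    (SfV_nonneg n L M R' (fun _ => le_rfl)) hGf0 (nsqV_nonneg M)
    (fun W => (ScV_eq_zero_add n M R G W).le) (fun W' => (SfV_eq_zero_add n L M R' G' W').ge) hnL.le hΛ hCP hCR' hδ hε'' hnormV hUBf hPf hFEDcurl hAVGG hREGf φ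

/-- **THE BRACKET PAIR WITH NO SLICE LAW, VECTOR LETTERS, LINE-INDEXED ONE-STEP AVERAGE** — the `hbr k φ` binder of `towerLimitRate_effV_of_pairs` (p218948):
sockets hUBc ∕ hUBf ∕ hPc ∕ hPf ∕ hFEDcurl ∕ **hAVGG** ∕ **hREGf** (lower) and hONEm ∕ hREG (upper); defects `eV Λ (C_P + C_R′) (δ + ε″)` ∕ `ePV Λ C_P C_R ε₁ δ′`.
[folklore] -/
theorem vector_pair_bracket_sqrt_avgG_line [FiniteDimensional ℂ E]
    {R : Tor (fine n M) → Fin d → (E →L[ℂ] E)} {R' : Tor (fine L (fine n M)) → Fin d → (E →L[ℂ] E)}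
    {G : (Tor (fine n M) → Fin d → E) → ℝ} {G' : (Tor (fine L (fine n M)) → Fin d → E) → ℝ}
    {Qk : (Tor (fine n M) → Fin d → E) → (Tor M → Fin d → E)} {T' : Tor (fine n M) → (Fin d → Fin L) → Fin L → Fin d → (E →L[ℂ] E)}
    (hQk : Continuous Qk) (hG0 : ∀ W, 0 ≤ G W) (hGc : Continuous G) (hG0' : ∀ W', 0 ≤ G' W') (hGc' : Continuous G')
    {Λ CP CR CR' δ ε₁ δ' ε'' : ℝ} (hΛ : 0 ≤ Λ) (hCP : 0 ≤ CP) (hCR : 0 ≤ CR) (hCR' : 0 ≤ CR') (hδ : 0 ≤ δ) (hε₁ : 0 ≤ ε₁) (hδ' : 0 ≤ δ')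
    (hε'' : 0 ≤ ε'') {ρ : (Tor (fine n M) → Fin d → E) → ℝ} (hρ0 : ∀ W, 0 ≤ ρ W) {ρ' : (Tor (fine L (fine n M)) → Fin d → E) → ℝ}
    (hUBc : ∀ φ : Tor M → Fin d → E, ∃ W, Qk W = φ ∧ ScV n M R G W ≤ Λ * nsqV M φ)
    (hUBf : ∀ φ : Tor M → Fin d → E, ∃ W', Qk (QvL L (fine n M) T' W') = φ ∧ SfV n L M R' G' W' ≤ Λ * nsqV M φ)
    (hPc : ∀ W, qWV n M W ≤ CP * (ScV n M R G W + nsqV M (Qk W)))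
    (hPf : ∀ W', qVV n L M W' ≤ CP * (SfV n L M R' G' W' + nsqV M (Qk (QvL L (fine n M) T' W'))))
    (hFEDcurl : ∀ W', ScV n M R (fun _ => 0) (QvL L (fine n M) T' W')
      ≤ (Real.sqrt (SfV n L M R' (fun _ => 0) W') + δ * Real.sqrt (qVV n L M W')) ^ 2)
    (hAVGG : ∀ (φ : Tor M → Fin d → E) (g₀ : Tor (fine L (fine n M)) → Fin d → E), Qk (QvL L (fine n M) T' g₀) = φ →
      (∀ W', Qk (QvL L (fine n M) T' W') = φ → SfV n L M R' G' g₀ ≤ SfV n L M R' G' W') →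
      ((n : ℝ) ^ d)⁻¹ * ((n : ℝ) ^ 2 * G (QvL L (fine n M) T' g₀))
        ≤ (Real.sqrt ((((n : ℝ) * L) ^ d)⁻¹ * (((n : ℝ) * L) ^ 2 * G' g₀)) + ε'' * Real.sqrt (ρ' g₀)) ^ 2)
    (hREGf : ∀ (φ : Tor M → Fin d → E) g, Qk (QvL L (fine n M) T' g) = φ →
      (∀ W', Qk (QvL L (fine n M) T' W') = φ → SfV n L M R' G' g ≤ SfV n L M R' G' W') → ρ' g ≤ CR' * (SfV n L M R' G' g + nsqV M φ))
    (hONEm : ∀ (φ : Tor M → Fin d → E) (W₀ : Tor (fine n M) → Fin d → E), Qk W₀ = φ → (∀ W, Qk W = φ → ScV n M R G W₀ ≤ ScV n M R G W) →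
      ∃ g, Qk (QvL L (fine n M) T' g) = φ ∧ SfV n L M R' G' g ≤ (Real.sqrt (ScV n M R G W₀ + ε₁ * ρ W₀) + δ' * Real.sqrt (qWV n M W₀)) ^ 2)
    (hREG : ∀ (φ : Tor M → Fin d → E) W, Qk W = φ → (∀ W₂, Qk W₂ = φ → ScV n M R G W ≤ ScV n M R G W₂) →
      ρ W ≤ CR * (ScV n M R G W + nsqV M φ))
    (φ : Tor M → Fin d → E) :
    blockSpin Qk (ScV n M R G) φ ≤ blockSpin (Qk ∘ QvL L (fine n M) T') (SfV n L M R' G') φ + eV Λ (CP + CR') (δ + ε'') * nsqV M φ ∧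
      blockSpin (Qk ∘ QvL L (fine n M) T') (SfV n L M R' G') φ ≤ blockSpin Qk (ScV n M R G) φ + ePV Λ CP CR ε₁ δ' * nsqV M φ := by
  have hn0 : (0 : ℝ) < (n : ℝ) ^ d := by have := Nat.pos_of_ne_zero (NeZero.ne n); positivity
  have hnL : (0 : ℝ) < ((n : ℝ) * L) ^ d := by
    have := Nat.pos_of_ne_zero (NeZero.ne n); have := Nat.pos_of_ne_zero (NeZero.ne L); positivity
  have hL1 : (1 : ℝ) ≤ L := by exact_mod_cast Nat.one_le_iff_ne_zero.mpr (NeZero.ne L)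
  have hnormW : ∀ W : Tor (fine n M) → Fin d → E, ‖W‖ ^ 2 ≤ ((n : ℝ) * L) ^ d * qWV n M W := fun W => by
    refine (norm_sq_le_nsqV W).trans ?_
    unfold qWV
    rw [mul_pow, mul_comm ((n : ℝ) ^ d), mul_assoc, ← mul_assoc ((n : ℝ) ^ d), mul_inv_cancel₀ hn0.ne', one_mul]
    exact le_mul_of_one_le_left (nsqV_nonneg _ W) (one_le_pow₀ hL1)
  have hnormV : ∀ W' : Tor (fine L (fine n M)) → Fin d → E, ‖W'‖ ^ 2 ≤ ((n : ℝ) * L) ^ d * qVV n L M W' := fun W' => by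
    unfold qVV
    rw [← mul_assoc, mul_inv_cancel₀ hnL.ne', one_mul]
    exact norm_sq_le_nsqV W'
  have hGf0 : ∀ W', 0 ≤ (((n : ℝ) * L) ^ d)⁻¹ * (((n : ℝ) * L) ^ 2 * G' W') := fun W' => by have := hG0' W'; positivity
  exact pair_bracket_sqrt_avgG (V := Tor (fine L (fine n M)) → Fin d → E) (W := Tor (fine n M) → Fin d → E) (Z := Tor M → Fin d → E)
    (Qk := Qk) (Q₁ := QvL L (fine n M) T') (Sc := ScV n M R G) (Scc := ScV n M R (fun _ => 0)) (Gc := fun W => ((n : ℝ) ^ d)⁻¹ * ((n : ℝ) ^ 2 * G W))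
    (Sf := SfV n L M R' G') (Sff := SfV n L M R' (fun _ => 0)) (Gf := fun W' => (((n : ℝ) * L) ^ d)⁻¹ * (((n : ℝ) * L) ^ 2 * G' W'))
    (qW := qWV n M) (qV := qVV n L M) (qZ := nsqV M) (ρ := ρ) (ρ' := ρ')
    hQk (continuous_QvL L (fine n M) T') (continuous_ScV n M R hGc) (continuous_SfV n L M R' hGc') (ScV_nonneg n M R hG0) (SfV_nonneg n L M R' hG0')
    (SfV_nonneg n L M R' (fun _ => le_rfl)) hGf0 (qWV_nonneg n M) (nsqV_nonneg M) hρ0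
    (fun W => (ScV_eq_zero_add n M R G W).le) (fun W' => (SfV_eq_zero_add n L M R' G' W').ge) hnL.le hΛ hCP hCR hCR' hδ hε₁ hδ' hε'' hnormW hnormV
    hUBc hUBf hPc hPf hFEDcurl hAVGG hREGf hONEm hREG φ

end Vector

end Summit.QuantumFields.BalabanUV.T4Continuum.VariationalVectorLowerAvgG

end
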